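import Mathlib
import Summits.Ventures.PercRepro2.SwOutJunctionH1GTypedEdgeLift

/-!
# THE (H1) JUNCTION WITH THE EDGE `h–u` ON THE GENERAL DOUBLY TYPED SIDE, II: the theorem (blind
cell PercRepro2, night-4 g33, 2026-08-28; proofs/NIGHT4-G33.md §6)

g29's one-edge theorem (`rigidOK_of_junctionH1_edge`, SwOutJunctionH1EdgeThm) for g7's general
doubly typed row: the junction `u` is joined to `h` by ONE edge `e₀`; in the subdivided graph `G⁺`
(`e₀` split at `w`, the outside edge `w–l` added) the (H1) theorem on the general doubly typed side
applies with the families lifted along `some` (the exempt set lifted, `w` carrying its outside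
edge: `subd_hF`, `subd_hout_g`, `subd_hX`), its block decomposition is summed over the uniform
points only (`card_le_of_blocks_on_g`, `uniform_of_mem_blockOf_g`), and the uniform points are the
uniform lifts of the side of `G` (`card_red_eq_g`, `card_blue_eq_g`):
**`rigidOK_g_of_junctionH1_edge`**, and on the graph **`gTypedSwAll_of_junctionH1_edge`**.
-/

namespace Summit.Ventures.PercRepro2

namespace LocRows

open Hull

variable {V : Type*} {E : Type*} [Fintype E] [DecidableEq E]

open scoped Classical

/-! ## The counts transport -/

section Counts

variable {ends : E → Sym2 V} {e₀ : E} {l h u : V} {U : Set V} {𝓤 𝓓 𝓓'' : Set (Set V)}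
  {X : Set V} {𝓤' : Set (Set V)}

/-- The general doubly typed class is empty unless `h ∈ U`. -/
lemma gOutSide_eq_empty_of_notMem (hh : h ∉ U) (ξ : Config E) :
    gOutSide ends l h 𝓤 𝓓 𝓓'' X 𝓤' U ξ = ∅ := by
  ext ζ
  simp only [Finset.notMem_empty, iff_false]
  intro hζ
  exact hh ((mem_outClass.1 (mem_gOutSide.1 hζ).2).2 (Or.inl (mem_cluster_self _ _ _)))

/-- `l` is not in the red cluster of `h` on the general doubly typed side. -/
lemma l_notMem_cluster_of_mem_gOutSide {ξ ζ : Config E}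
    (hζ : ζ ∈ gOutSide ends l h 𝓤 𝓓 𝓓'' X 𝓤' U ξ) : l ∉ cluster ends ζ h :=
  fun hl' => l_notMem_hull_of_mem_gTypedQ (mem_gOutSide.1 hζ).1 (Or.inl hl')

/-- `l` is not in the blue cluster of `h` on the general doubly typed side. -/
lemma l_notMem_cluster_blue_of_mem_gOutSide {ξ ζ : Config E}
    (hζ : ζ ∈ gOutSide ends l h 𝓤 𝓓 𝓓'' X 𝓤' U ξ) : l ∉ cluster ends (blue ζ) h :=
  fun hl' => l_notMem_hull_of_mem_gTypedQ (mem_gOutSide.1 hζ).1 (Or.inr hl')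

/-- **The uniform side of `G⁺` is the image of the side of `G` under the uniform lift**, with the red
edge sets pushed along. -/
lemma filter_uniform_red_eq_image_g (he₀ : ends e₀ = s(h, u)) (hl : l ∉ U) (hh : h ∈ U)
    (ξ : Config E) (𝓔 : Set (Set E)) :
    ((gOutSide (subdEnds ends e₀ h u l) (some l) (some h) ({S : Set (Option V) | some ⁻¹' S ∈ 𝓤}) ({S : Set (Option V) | some ⁻¹' S ∈ 𝓓}) ({S : Set (Option V) | some ⁻¹' S ∈ 𝓓''})
        (some '' X) ({S : Set (Option V) | some ⁻¹' S ∈ 𝓤'}) (subdRegion U) (ulift e₀ ξ)).filter fun ζ' => Uniform e₀ ζ' ∧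
          redEdges (subdEnds ends e₀ h u l) ζ' (some h) ∈ {F | subdPull e₀ F ∈ 𝓔}) =
      ((gOutSide ends l h 𝓤 𝓓 𝓓'' X 𝓤' U ξ).filter fun ζ => redEdges ends ζ h ∈ 𝓔).image
        (ulift e₀) := by
  ext ζ'
  simp only [Finset.mem_filter, Finset.mem_image, Set.mem_setOf_eq]
  constructor
  · rintro ⟨hζ', hun, hE⟩
    set ζ := ζ' ∘ Sum.inl with hζdef
    have heq : ζ' = ulift e₀ ζ := eq_ulift_of_uniform hl (mem_gOutSide.1 hζ').2 hun
    rw [heq] at hζ' hE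
    have hζ : ζ ∈ gOutSide ends l h 𝓤 𝓓 𝓓'' X 𝓤' U ξ := (mem_gOutSide_ulift_iff he₀ hh).1 hζ'
    refine ⟨ζ, ⟨hζ, ?_⟩, heq.symm⟩
    rwa [redEdges_ulift he₀ (l_notMem_cluster_of_mem_gOutSide hζ), subdPull_subdPush] at hE
  · rintro ⟨ζ, ⟨hζ, hE⟩, rfl⟩
    refine ⟨(mem_gOutSide_ulift_iff he₀ hh).2 hζ, uniform_ulift ζ, ?_⟩
    rw [redEdges_ulift he₀ (l_notMem_cluster_of_mem_gOutSide hζ), subdPull_subdPush]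
    exact hE

/-- The blue counterpart of `filter_uniform_red_eq_image_g`. -/
lemma filter_uniform_blue_eq_image_g (he₀ : ends e₀ = s(h, u)) (hl : l ∉ U) (hh : h ∈ U)
    (ξ : Config E) (𝓔 : Set (Set E)) :
    ((gOutSide (subdEnds ends e₀ h u l) (some l) (some h) ({S : Set (Option V) | some ⁻¹' S ∈ 𝓤}) ({S : Set (Option V) | some ⁻¹' S ∈ 𝓓}) ({S : Set (Option V) | some ⁻¹' S ∈ 𝓓''})
        (some '' X) ({S : Set (Option V) | some ⁻¹' S ∈ 𝓤'}) (subdRegion U) (ulift e₀ ξ)).filter fun ζ' => Uniform e₀ ζ' ∧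
          blueEdges (subdEnds ends e₀ h u l) ζ' (some h) ∈ {F | subdPull e₀ F ∈ 𝓔}) =
      ((gOutSide ends l h 𝓤 𝓓 𝓓'' X 𝓤' U ξ).filter fun ζ => blueEdges ends ζ h ∈ 𝓔).image
        (ulift e₀) := by
  ext ζ'
  simp only [Finset.mem_filter, Finset.mem_image, Set.mem_setOf_eq]
  constructor
  · rintro ⟨hζ', hun, hE⟩
    set ζ := ζ' ∘ Sum.inl with hζdef
    have heq : ζ' = ulift e₀ ζ := eq_ulift_of_uniform hl (mem_gOutSide.1 hζ').2 hun
    rw [heq] at hζ' hE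
    have hζ : ζ ∈ gOutSide ends l h 𝓤 𝓓 𝓓'' X 𝓤' U ξ := (mem_gOutSide_ulift_iff he₀ hh).1 hζ'
    refine ⟨ζ, ⟨hζ, ?_⟩, heq.symm⟩
    rwa [blueEdges_ulift he₀ (l_notMem_cluster_blue_of_mem_gOutSide hζ), subdPull_subdPush] at hE
  · rintro ⟨ζ, ⟨hζ, hE⟩, rfl⟩
    refine ⟨(mem_gOutSide_ulift_iff he₀ hh).2 hζ, uniform_ulift ζ, ?_⟩
    rw [blueEdges_ulift he₀ (l_notMem_cluster_blue_of_mem_gOutSide hζ), subdPull_subdPush]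
    exact hE

/-- **The red count transports** to the uniform part of the class of `G⁺`. -/
lemma card_red_eq_g (he₀ : ends e₀ = s(h, u)) (hl : l ∉ U) (hh : h ∈ U) (ξ : Config E)
    (𝓔 : Set (Set E)) :
    ((gOutSide ends l h 𝓤 𝓓 𝓓'' X 𝓤' U ξ).filter fun ζ => redEdges ends ζ h ∈ 𝓔).card =
      ((gOutSide (subdEnds ends e₀ h u l) (some l) (some h) ({S : Set (Option V) | some ⁻¹' S ∈ 𝓤}) ({S : Set (Option V) | some ⁻¹' S ∈ 𝓓})
        ({S : Set (Option V) | some ⁻¹' S ∈ 𝓓''}) (some '' X) ({S : Set (Option V) | some ⁻¹' S ∈ 𝓤'}) (subdRegion U) (ulift e₀ ξ)).filter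
          fun ζ' => Uniform e₀ ζ' ∧
            redEdges (subdEnds ends e₀ h u l) ζ' (some h) ∈ {F | subdPull e₀ F ∈ 𝓔}).card := by
  rw [filter_uniform_red_eq_image_g he₀ hl hh ξ 𝓔,
    Finset.card_image_of_injective _ ulift_injective]

/-- **The blue count transports** to the uniform part of the class of `G⁺`. -/
lemma card_blue_eq_g (he₀ : ends e₀ = s(h, u)) (hl : l ∉ U) (hh : h ∈ U) (ξ : Config E)
    (𝓔 : Set (Set E)) :
    ((gOutSide ends l h 𝓤 𝓓 𝓓'' X 𝓤' U ξ).filter fun ζ => blueEdges ends ζ h ∈ 𝓔).card =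
      ((gOutSide (subdEnds ends e₀ h u l) (some l) (some h) ({S : Set (Option V) | some ⁻¹' S ∈ 𝓤}) ({S : Set (Option V) | some ⁻¹' S ∈ 𝓓})
        ({S : Set (Option V) | some ⁻¹' S ∈ 𝓓''}) (some '' X) ({S : Set (Option V) | some ⁻¹' S ∈ 𝓤'}) (subdRegion U) (ulift e₀ ξ)).filter
          fun ζ' => Uniform e₀ ζ' ∧
            blueEdges (subdEnds ends e₀ h u l) ζ' (some h) ∈ {F | subdPull e₀ F ∈ 𝓔}).card := by
  rw [filter_uniform_blue_eq_image_g he₀ hl hh ξ 𝓔,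
    Finset.card_image_of_injective _ ulift_injective]

end Counts

/-! ## The hypotheses in `G⁺` -/

section Hyp

variable {ends : E → Sym2 V} {e₀ : E} {h u l : V} {U : Set V} {𝓤 : Set (Set V)} {X : Set V}
  {F : V → Prop}

omit [Fintype E] [DecidableEq E] in
/-- The lifted exemption is forced into `C_R(l)` by the lifted up-set. -/
lemma subd_hF (hF : ∀ x, F x → ∀ S ∈ 𝓤, x ∈ S) :
    ∀ x : Option V, (∃ v, x = some v ∧ F v) →
      ∀ S ∈ {S : Set (Option V) | some ⁻¹' S ∈ 𝓤}, x ∈ S := by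
  rintro x ⟨v, rfl, hv⟩ S hS
  exact hF v hv _ hS

omit [Fintype E] in
/-- **Every vertex of `U⁺ ∖ {h, u}` is exempt, in `X⁺`, carries an outside edge or no edge**: `w`
has the edge `w–l`, the vertices of `G` what they had. -/
lemma subd_hout_g (hl : l ∉ U) (he₀ : ends e₀ = s(h, u))
    (hout : ∀ x ∈ U, x ≠ h → x ≠ u →
      F x ∨ x ∈ X ∨ (∃ e y, ends e = s(x, y) ∧ y ∉ U) ∨ (∀ e, x ∉ ends e)) :
    ∀ x ∈ subdRegion U, x ≠ some h → x ≠ some u →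
      (∃ v, x = some v ∧ F v) ∨ x ∈ some '' X ∨
        (∃ e y, subdEnds ends e₀ h u l e = s(x, y) ∧ y ∉ subdRegion U) ∨
          (∀ e, x ∉ subdEnds ends e₀ h u l e) := by
  rintro (_ | v) hx hxh hxu
  · exact Or.inr (Or.inr (Or.inl ⟨Sum.inr true, some l, by simp, by simpa using hl⟩))
  · rw [some_mem_subdRegion_iff] at hx
    have hvh : v ≠ h := fun h' => hxh (by rw [h'])
    have hvu : v ≠ u := fun h' => hxu (by rw [h'])
    have hvl : v ≠ l := fun h' => hl (h' ▸ hx)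
    rcases hout v hx hvh hvu with hf | hvX | ⟨e, y, hey, hyU⟩ | hiso
    · exact Or.inl ⟨v, rfl, hf⟩
    · exact Or.inr (Or.inl ⟨v, hvX, rfl⟩)
    · have hee : e ≠ e₀ := by
        rintro rfl
        rw [he₀, Sym2.eq_iff] at hey
        rcases hey with ⟨h1, _⟩ | ⟨_, h2⟩
        · exact hvh h1.symm
        · exact hvu h2.symm
      exact Or.inr (Or.inr (Or.inl ⟨Sum.inl e, some y,
        by rw [subdEnds_inl_of_ne hee, hey, Sym2.map_mk], by simpa using hyU⟩))
    · exact Or.inr (Or.inr (Or.inr (subd_notMem_of_notMem hiso hvh hvu hvl)))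

omit [Fintype E] in
/-- The vertices of `X⁺` inside `U⁺` carry loops only in `G⁺`. -/
lemma subd_hX (hl : l ∉ U) (hhX : h ∉ X) (huX : u ∉ X)
    (hX : ∀ x ∈ X, x ∈ U → ∀ e, x ∈ ends e → ends e = s(x, x)) :
    ∀ x ∈ some '' X, x ∈ subdRegion U → ∀ e, x ∈ subdEnds ends e₀ h u l e →
      subdEnds ends e₀ h u l e = s(x, x) := by
  rintro _ ⟨v, hv, rfl⟩ hxU e hxe
  rw [some_mem_subdRegion_iff] at hxU
  have hvh : v ≠ h := fun h' => hhX (h' ▸ hv)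
  have hvu : v ≠ u := fun h' => huX (h' ▸ hv)
  have hvl : v ≠ l := fun h' => hl (h' ▸ hxU)
  rcases e with e | b
  · by_cases hee : e = e₀
    · subst hee
      rw [subdEnds_inl_self, Sym2.mem_iff] at hxe
      rcases hxe with h' | h'
      · exact absurd (Option.some_injective _ h') hvh
      · exact absurd h' (by simp)
    · rw [subdEnds_inl_of_ne hee] at hxe ⊢
      obtain ⟨a, b, hab⟩ := exists_pair_eq (ends e)
      rw [hab, Sym2.map_mk, Sym2.mem_iff] at hxe
      have hve : v ∈ ends e := by
        rw [hab, Sym2.mem_iff]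
        rcases hxe with h' | h'
        · exact Or.inl (Option.some_injective _ h')
        · exact Or.inr (Option.some_injective _ h')
      rw [hX v hv hxU e hve, Sym2.map_mk]
  · cases b
    · rw [subdEnds_inr_false, Sym2.mem_iff] at hxe
      rcases hxe with h' | h'
      · exact absurd h' (by simp)
      · exact absurd (Option.some_injective _ h') hvu
    · rw [subdEnds_inr_true, Sym2.mem_iff] at hxe
      rcases hxe with h' | h'
      · exact absurd h' (by simp)
      · exact absurd (Option.some_injective _ h') hvl

end Hyp

/-! ## The theorem -/

section Main

variable {ends : E → Sym2 V} {e₀ : E} {l h u : V} {U : Set V} {𝓤 𝓓 𝓓'' : Set (Set V)}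
  {X : Set V} {𝓤' : Set (Set V)} {F : V → Prop}

/-- **THE (H1) JUNCTION WITH THE EDGE `h–u`, GENERAL DOUBLY TYPED SIDE**: the rigid counting
inequality on `gTypedQ` over every class of a single-junction region whose junction `u` is joined
to `h` by exactly one edge `e₀` (no loop at `h` or `u`, every other vertex of `U ∖ {h}` exempt —
forced into `C_R(l)` by `𝓤` — in `X`, with an outside edge, or with no edge; the vertices of `X`
inside `U` with loops only, `h, u ∉ X`; (H1)), for every outside colouring `ξ`. -/
theorem rigidOK_g_of_junctionH1_edge (h𝓤 : IsUpperSet 𝓤) (h𝓓 : IsLowerSet 𝓓)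
    (h𝓓'' : IsLowerSet 𝓓'') (h𝓤' : IsUpperSet 𝓤') (hl : l ∉ U) (hhu : h ≠ u)
    (hloop_h : ∀ e, ends e ≠ s(h, h)) (hloop_u : ∀ e, ends e ≠ s(u, u)) (he₀ : ends e₀ = s(h, u))
    (huniq : ∀ e, ends e = s(h, u) → e = e₀) (hF : ∀ x, F x → ∀ S ∈ 𝓤, x ∈ S)
    (hout : ∀ x ∈ U, x ≠ h → x ≠ u →
      F x ∨ x ∈ X ∨ (∃ e y, ends e = s(x, y) ∧ y ∉ U) ∨ (∀ e, x ∉ ends e))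
    (hH1 : H1 ends U h u) (hhX : h ∉ X) (huX : u ∉ X)
    (hX : ∀ x ∈ X, x ∈ U → ∀ e, x ∈ ends e → ends e = s(x, x)) (ξ : Config E)
    {𝓔 : Set (Set E)} (h𝓔 : IsUpperSet 𝓔) :
    ((gOutSide ends l h 𝓤 𝓓 𝓓'' X 𝓤' U ξ).filter fun ζ => redEdges ends ζ h ∈ 𝓔).card ≤
      ((gOutSide ends l h 𝓤 𝓓 𝓓'' X 𝓤' U ξ).filter fun ζ => blueEdges ends ζ h ∈ 𝓔).card := by
  by_cases hh : h ∈ U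
  swap
  · rw [gOutSide_eq_empty_of_notMem hh]
    simp
  have hl' : some l ∉ subdRegion U := subd_hl hl
  have hhu' : (some h : Option V) ≠ some u := subd_hhu hhu
  have hloop_h' : ∀ e, subdEnds ends e₀ h u l e ≠ s(some h, some h) := subd_loop_h hloop_h
  have hloop_u' : ∀ e, subdEnds ends e₀ h u l e ≠ s(some u, some u) := subd_loop_u hloop_u
  have hnadj' : ∀ e, subdEnds ends e₀ h u l e ≠ s(some h, some u) := subd_nadj huniq
  have hF' := subd_hF (𝓤 := 𝓤) hF
  have hout' := subd_hout_g hl he₀ hout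
  have hhX' : (some h : Option V) ∉ some '' X := by
    rintro ⟨v, hv, hvh⟩
    exact hhX ((Option.some_injective _ hvh) ▸ hv)
  have huX' : (some u : Option V) ∉ some '' X := by
    rintro ⟨v, hv, hvu⟩
    exact huX ((Option.some_injective _ hvu) ▸ hv)
  have hX' := subd_hX (e₀ := e₀) (ends := ends) hl hhX huX hX
  have hH1' : H1 (subdEnds ends e₀ h u l) (subdRegion U) (some h) (some u) :=
    subd_H1 hl hhu hloop_u he₀ hH1
  have hUp := isUpperSet_liftSome (V := V) h𝓤
  have hDp := isLowerSet_liftSome (V := V) h𝓓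
  have hDpp := isLowerSet_liftSome (V := V) h𝓓''
  have hUpp := isUpperSet_liftSome (V := V) h𝓤'
  rw [card_red_eq_g he₀ hl hh ξ 𝓔, card_blue_eq_g he₀ hl hh ξ 𝓔]
  exact card_le_of_blocks_on_g
    (keyOf (subdEnds ends e₀ h u l) (subdRegion U) (ulift e₀ ξ) (some h) (some u))
    (blockOf (subdEnds ends e₀ h u l) (some h) (some u)) (Uniform e₀)
    (fun _ hζ => mem_blockOf_keyOf_g hl' hhu' hF' hout' hX' hζ)
    (fun _ hζ _ hζ' hQ =>
      keyOf_eq_of_mem_blockOf_g hUp hDp hDpp hUpp hl' hhu' hloop_h' hloop_u' hnadj' hF' hout' hH1'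
        hhX' huX' hX' hζ hζ' hQ)
    (fun _ hζ hun _ hζ' =>
      uniform_of_mem_blockOf_g hl' hhu hloop_h' hloop_u' hnadj' hF' hout' hX' hH1' hζ hun hζ')
    (fun _ hζ _ h𝓔' =>
      card_blockOf_le_g hUp hDp hDpp hUpp hl' hhu' hloop_h' hloop_u' hnadj' hF' hout' hH1' hhX'
        huX' hX' hζ h𝓔')
    (isUpperSet_subdPull_preimage h𝓔)

/-- **The general doubly typed row on every graph with one (H1) junction joined to `h` by a
single edge**: `u ≠ l, h`, no loop at `h` or `u`, `e₀` the only edge `h–u`, (H1) in `{l}ᶜ`; every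
other vertex exempt (forced into `C_R(l)` by the up-set `𝓤`), in `X`, joined to `l`, or isolated;
the vertices of `X` other than `l` with loops only, `h, u ∉ X`; `𝓤, 𝓤′` up-sets, `𝓓, 𝓓″`
down-sets. -/
theorem gTypedSwAll_of_junctionH1_edge (hlh : l ≠ h) (hlu : l ≠ u) (hhu : h ≠ u)
    (hloop_h : ∀ e, ends e ≠ s(h, h)) (hloop_u : ∀ e, ends e ≠ s(u, u))
    (he₀ : ends e₀ = s(h, u)) (huniq : ∀ e, ends e = s(h, u) → e = e₀)
    (hH1 : H1 ends ({l}ᶜ) h u)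
    (h𝓤 : IsUpperSet 𝓤) (h𝓓 : IsLowerSet 𝓓) (h𝓓'' : IsLowerSet 𝓓'') (h𝓤' : IsUpperSet 𝓤')
    (hF : ∀ x, F x → ∀ S ∈ 𝓤, x ∈ S) (hhX : h ∉ X) (huX : u ∉ X)
    (hX : ∀ x ∈ X, x ≠ l → ∀ e, x ∈ ends e → ends e = s(x, x))
    (hout : ∀ x, x ≠ l → x ≠ h → x ≠ u →
      F x ∨ x ∈ X ∨ (∃ e, ends e = s(x, l)) ∨ (∀ e, x ∉ ends e)) :
    GTypedSwAll ends l h 𝓤 𝓓 𝓓'' X 𝓤' := by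
  have _hlu := hlu
  refine exists_swAll_injection_of_card_le h _ (card_le_g_of_classes hlh fun ξ 𝓔 h𝓔 => ?_)
  refine rigidOK_g_of_junctionH1_edge (e₀ := e₀) (u := u) (F := F) h𝓤 h𝓓 h𝓓'' h𝓤' (by simp) hhu
    hloop_h hloop_u he₀ huniq hF ?_ hH1 hhX huX ?_ ξ h𝓔
  · intro x hx hxh hxu
    rcases hout x (by simpa using hx) hxh hxu with hf | hxX | ⟨e, he⟩ | hiso
    · exact Or.inl hf
    · exact Or.inr (Or.inl hxX)
    · exact Or.inr (Or.inr (Or.inl ⟨e, l, he, by simp⟩))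
    · exact Or.inr (Or.inr (Or.inr hiso))
  · intro x hx hxU
    exact hX x hx (by simpa using hxU)

end Main

end LocRows

end Summit.Ventures.PercRepro2
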